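import Mathlib
import Literature.Analysis.FluidPDE.BoundedL2ClassicalMild
import Literature.Analysis.FluidPDE.AncientMildCurlCompactness
import Literature.Analysis.FluidPDE.KNSSTypeIRateLiouvilleMild
import Summits.NavierStokesRegularity.NavierStokesRegularity.Theorems.PlaneEnergyCeilingBoundedPlanarEnergyRegularityZoomWindowLipschitz
import Summits.NavierStokesRegularity.NavierStokesRegularity.Theorems.PlaneEnergyCeilingBoundedPlanarEnergyRegularityZoomFinalTime
import HarnessLib

/-!
# `VorticityPace.PaceZoom` (item stmt-NavierStokesRegularity-7781) — tools:
# KNSS Lemma 6.1 with a certified vorticity at the apex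

Helper file for the support item `Theses.VorticityPace.PaceZoom` (the vorticity-centred KNSS zoom),
proved in `VorticityPacePaceZoom.lean`. The engine isolated here
(`PaceZoom.exists_ancientMild_of_certifiedZoom`): let `(V_j, P_j)` be classical solutions of
unforced Navier–Stokes (`ν = 1`) on `(A_j, B_j) × ℝ³` with `A_j → −∞`, `A_j ≤ −2 < 0 < B_j`,
`‖V_j‖ ≤ 1` on `(A_j, 0]`, square-integrable slices with a uniform `L²` bound on `(A_j, 0]`, and a
CERTIFIED vorticity `‖curl V_j(0)(0)‖ = θ₀ > 0` at the apex. Then some bounded ancient mild solution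
`W` (`ν = 1`, duality form, measurable slices) has a slice `s < 0` which is not a.e. constant.

PROOF.
1. Each `V_j` is Oseen-mild on `(A_j, 0)` (KNSS Lemma 3.1 with the parasitic drift killed by
   finite energy: `mild_of_bounded_of_eLpNorm_two_le_of_lt`), continuous, weakly divergence free.
2. KNSS Lemma 6.1 with vorticity (`exists_ancientMild_limit_curl_tendsto`): a subsequence
   converges, together with its curls, at every `t < 0`, to a bounded smooth Oseen-mild ancient
   field `W`; `W` is a bounded ancient mild solution (`isBoundedAncientMildSolution_of_oseen`).
3. The certified slice is moved off the final time WITHOUT forward continuation: the uniform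
   space–time Lipschitz bound up to `s = 0` (`lipschitz_up_to_final_time_of_memLp`), the
   window-uniform bound on `D²V_j` (KNSS (4.10), `exists_iteratedFDeriv_bound_of_bounded_oseenMild`)
   and Landau's two-function inequality (`DerivInterp.norm_iteratedFDeriv_succ_sub_le`) give
   `‖curl V_j(s)(0) − curl V_j(−c)(0)‖ ≤ θ₀/2` for `s ∈ (−c, 0)`, uniformly in `j`, for one small
   `c > 0`; letting `s ↑ 0` (joint smoothness of a classical solution), `‖curl V_j(−c)(0)‖ ≥ θ₀/2`,
   hence `‖curl W(−c)(0)‖ ≥ θ₀/2` in the limit.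
4. A continuous slice a.e. equal to a constant is constant and has zero curl.

HONEST FRAMING: a compactness lemma about HYPOTHETICAL rescaled blow-up sequences (other route,
not a pub-ns-dss cell file); nothing here bears on the regularity problem itself.

References: Koch–Nadirashvili–Seregin–Šverák 2009, §4 Prop. 4.1 and §6 Lemma 6.1
(arXiv:0709.3599); Giga–Miura 2011 §2.1. [KochNadirashviliSereginSverak2009] [GigaMiura2011]
-/

noncomputable section

set_option linter.dupNamespace false

namespace Summit.NavierStokesRegularity.NavierStokesRegularity.Theorems

open MeasureTheory Set Function Filter Topology TopologicalSpace Metric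
open scoped NNReal ENNReal ContDiff
open Literature.Analysis Literature.Analysis.FluidPDE

namespace PaceZoom

/-- **The vorticity of a zoomed slice**: `curl (y ↦ a • u(t₀ + β s, x₀ + γ y)) (y) =
(a γ) • curl u(t₀ + β s) (x₀ + γ y)` for a differentiable slice (chain rule). [folklore] -/
theorem curl_zoom_slice {a β γ t₀ : ℝ} {x₀ : EuclideanSpace ℝ (Fin 3)}
    {u : ℝ → EuclideanSpace ℝ (Fin 3) → EuclideanSpace ℝ (Fin 3)} {s : ℝ}
    (hd : Differentiable ℝ (u (t₀ + β * s))) (y : EuclideanSpace ℝ (Fin 3)) :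
    curl ((a • stPull β γ t₀ x₀ u) s) y = (a * γ) • curl (u (t₀ + β * s)) (x₀ + γ • y) := by
  -- adapted from `fderiv_smul_stPull_slice` / `curl_smul_stPull_slice`
  -- (Theorems/IsobarTomographyTubeAlternativeStubTwoSidedVorticityRate.lean)
  have hd' : Differentiable ℝ (stPull β γ t₀ x₀ u s) := differentiable_stPull_slice hd
  rw [curl_eq_curlCLM, curl_eq_curlCLM,
    show (a • stPull β γ t₀ x₀ u) s = fun z => a • stPull β γ t₀ x₀ u s z from rfl,
    fderiv_fun_const_smul (hd' y), fderiv_stPull, smul_smul, map_smul]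

/-- **Small positive multipliers**: for `b > 0` there is `x ∈ (0, 1)` with `a x ≤ b`. [folklore] -/
theorem exists_small_mul (a : ℝ) {b : ℝ} (hb : 0 < b) : ∃ x : ℝ, 0 < x ∧ x < 1 ∧ a * x ≤ b := by
  rcases le_or_gt a 0 with ha | ha
  · exact ⟨1 / 2, by norm_num, by norm_num, by nlinarith⟩
  · refine ⟨min (1 / 2) (b / a), lt_min (by norm_num) (div_pos hb ha),
      (min_le_left _ _).trans_lt (by norm_num), ?_⟩
    calc a * min (1 / 2) (b / a) ≤ a * (b / a) :=
          mul_le_mul_of_nonneg_left (min_le_right _ _) ha.le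
      _ = b := mul_div_cancel₀ _ ha.ne'

/-- **A continuous slice which is a.e. constant has zero vorticity** (a continuous function a.e.
equal to a constant is that constant, Lebesgue measure charging open sets). [folklore] -/
theorem curl_eq_zero_of_ae_eq_const {f : EuclideanSpace ℝ (Fin 3) → EuclideanSpace ℝ (Fin 3)}
    (hf : Continuous f) {b : EuclideanSpace ℝ (Fin 3)} (hb : f =ᵐ[volume] fun _ => b)
    (y : EuclideanSpace ℝ (Fin 3)) : curl f y = 0 := by
  have heq : f = fun _ => b := (Continuous.ae_eq_iff_eq volume hf continuous_const).1 hb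
  rw [heq, curl_eq_curlCLM]
  simp


/-- **KNSS Lemma 6.1 with a certified vorticity at the apex** (module docstring): classical
solutions `(V_j, P_j)` (`ν = 1`) on `(A_j, B_j) × ℝ³`, `A_j → −∞`, `A_j ≤ −2 < 0 < B_j`, bounded by
`1` on `(A_j, 0]`, with square-integrable slices uniformly bounded in `L²` on `(A_j, 0]`, and
`‖curl V_j(0)(0)‖ = θ₀ > 0`, yield a bounded ancient mild solution (`ν = 1`, duality form) with
measurable slices and a slice `s < 0` that is not a.e. constant.
[cite: KochNadirashviliSereginSverak2009, §4 Prop. 4.1 (4.10) and §6 Lemma 6.1 (arXiv:0709.3599 pp. 8, 11)] -/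
theorem exists_ancientMild_of_certifiedZoom {θ₀ : ℝ} (hθ₀ : 0 < θ₀) {A B : ℕ → ℝ}
    {V : ℕ → ℝ → EuclideanSpace ℝ (Fin 3) → EuclideanSpace ℝ (Fin 3)}
    {P : ℕ → ℝ → EuclideanSpace ℝ (Fin 3) → ℝ}
    (hAtend : Tendsto A atTop atBot) (hA2 : ∀ j, A j ≤ -2) (hBpos : ∀ j, 0 < B j)
    (hVcl : ∀ j, IsClassicalNSSolutionOn (Ioo (A j) (B j)) 1 0 (V j) (P j))
    (hVbd1 : ∀ j, ∀ s ∈ Ioc (A j) 0, ∀ y, ‖V j s y‖ ≤ 1)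
    (hVL2 : ∀ j, ∀ s ∈ Ioo (A j) (B j), MemLp (V j s) 2 volume)
    (hVK : ∀ j, ∃ K : ℝ≥0∞, K ≠ ⊤ ∧ ∀ s ∈ Ioc (A j) 0, eLpNorm (V j s) 2 volume ≤ K)
    (hVcurl0 : ∀ j, ‖curl (V j 0) 0‖ = θ₀) :
    ∃ W : ℝ → EuclideanSpace ℝ (Fin 3) → EuclideanSpace ℝ (Fin 3),
      IsBoundedAncientMildSolution 1 W ∧
      (∀ s < (0 : ℝ), AEStronglyMeasurable (W s) volume) ∧
      ∃ s < (0 : ℝ), ¬ ∃ b : EuclideanSpace ℝ (Fin 3), W s =ᵐ[volume] fun _ => b := by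
  have hVbd2 : ∀ j, ∀ s ∈ Ioc (A j) 0, ∀ y, ‖V j s y‖ ≤ 2 := fun j s hs y =>
    (hVbd1 j s hs y).trans one_le_two
  have hVbd1' : ∀ j, ∀ s ∈ Ioo (A j) 0, ∀ y, ‖V j s y‖ ≤ 1 := fun j s hs y =>
    hVbd1 j s ⟨hs.1, hs.2.le⟩ y
  -- continuity, divergence, energy, and the Oseen identity on `(A j, 0)`
  have hVcont : ∀ j, ContinuousOn (uncurry (V j)) (Ioo (A j) (B j) ×ˢ univ) := fun j =>
    (hVcl j).smooth_velocity.continuousOn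
  have hVcont0 : ∀ j, ContinuousOn (uncurry (V j)) (Ioo (A j) 0 ×ˢ univ) := fun j =>
    (hVcont j).mono (prod_mono (Ioo_subset_Ioo_right (hBpos j).le) Subset.rfl)
  have hVsm : ∀ j, ∀ s ∈ Ioo (A j) (B j), ContDiff ℝ ∞ (V j s) := fun j s hs =>
    (hVcl j).contDiff_velocity hs
  have hVdiv : ∀ j, ∀ s ∈ Ioo (A j) 0, IsWeaklyDivFree (V j s) := fun j s hs =>
    VectorCalculus.IsDivFree.isWeaklyDivFree_holds
      ((hVcl j).divFree s ⟨hs.1, hs.2.trans (hBpos j)⟩)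
      (contDiff_infty.1 (hVsm j s ⟨hs.1, hs.2.trans (hBpos j)⟩) 1)
  have hVmild : ∀ j, ∀ s t : ℝ, A j < s → s < t → t < 0 → ∀ x,
      V j t x = UnboundedOperators.heatExtension (V j s) (t - s) x -
        oseenDuhamel 1 s (V j) (V j) t x := fun j s t hAs hst ht0 x => by
    obtain ⟨K, hKtop, hK⟩ := hVK j
    exact mild_of_bounded_of_eLpNorm_two_le_of_lt (hVcl j) (hAs.trans (hst.trans ht0)) (hBpos j)
      (fun r hr y => hVbd1 j r hr y) hKtop (fun r hr => hK r hr) hAs hst ht0 x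
  -- ### Step 6: KNSS Lemma 6.1 with vorticity
  obtain ⟨φ, W, hφ, hWc, hWdiv, hWbd, hWmild, hWsm, -, -, hWcurl⟩ :=
    exists_ancientMild_limit_curl_tendsto (B := 1) hAtend hVcont0 hVdiv hVmild hVbd1'
  -- ### Step 7: moving the certified slice off the final time
  obtain ⟨K, hK0, hKprop⟩ := BoundedPlanarEnergyRegularity.lipschitz_of_memLp_two 2
  have hK8 : 0 ≤ max K 8 := hK0.trans (le_max_left _ _)
  have hLip : ∀ j, ∀ s ∈ Icc (A j + 1) 0, ∀ t ∈ Icc (A j + 1) 0,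
      ∀ x y : EuclideanSpace ℝ (Fin 3), ‖V j t x - V j s y‖ ≤ max K 8 * (|t - s| + ‖x - y‖) :=
    fun j => BoundedPlanarEnergyRegularity.lipschitz_up_to_final_time_of_memLp K hKprop (A j) (B j)
      (hA2 j) (hBpos j) (V j) (P j) (hVcl j) (hVbd2 j) (hVL2 j)
  obtain ⟨K₂, hK₂⟩ := exists_iteratedFDeriv_bound_of_bounded_oseenMild (1 : ℝ) 2
  have hD2 : ∀ j, ∀ t : ℝ, A j + 1 < t → t < 0 →
      ContDiff ℝ ∞ (V j t) ∧ ∀ y, ‖iteratedFDeriv ℝ 2 (V j t) y‖ ≤ K₂ := fun j t h1 h2 =>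
    hK₂ (hVcont0 j) (hVdiv j) (hVmild j) (hVbd1' j) t h1 h2
  have hK₂0 : 0 ≤ K₂ := by
    have h := (hD2 0 (-1 / 2) (by linarith [hA2 0]) (by norm_num)).2 0
    exact (norm_nonneg _).trans h
  set κ : ℝ := ‖curlCLM‖ with hκdef
  have hκ : 0 ≤ κ := by rw [hκdef]; exact norm_nonneg curlCLM
  -- the radius `ρ` and the time lag `cc`
  obtain ⟨ρ, hρ0, hρ1, hρs⟩ := exists_small_mul (κ * (2 * K₂)) (b := θ₀ / 4) (by positivity)
  obtain ⟨cc, hcc0, hcc1, hccs⟩ :=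
    exists_small_mul (κ * (2 * max K 8) / ρ) (b := θ₀ / 4) (by positivity)
  have hkey : ∀ j, ∀ s ∈ Ioo (-cc) 0, ‖curl (V j s) 0 - curl (V j (-cc)) 0‖ ≤ θ₀ / 2 := by
    intro j s hs
    have hs1 : A j + 1 < s := by linarith [hA2 j, hs.1]
    have hc1 : A j + 1 < -cc := by linarith [hA2 j]
    have hc2 : -cc < 0 := by linarith
    obtain ⟨hsm_s, hD_s⟩ := hD2 j s hs1 hs.2
    obtain ⟨hsm_c, hD_c⟩ := hD2 j (-cc) hc1 hc2
    have hA' : ∀ y ∈ ball (0 : EuclideanSpace ℝ (Fin 3)) 1,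
        ‖iteratedFDeriv ℝ 0 (V j s) y - iteratedFDeriv ℝ 0 (V j (-cc)) y‖ ≤ max K 8 * cc := by
      intro y _
      rw [DerivInterp.norm_iteratedFDeriv_zero_sub]
      have h := hLip j (-cc) ⟨hc1.le, hc2.le⟩ s ⟨hs1.le, hs.2.le⟩ y y
      rw [sub_self, norm_zero, add_zero, sub_neg_eq_add, abs_of_pos (by linarith [hs.1])] at h
      calc ‖V j s y - V j (-cc) y‖ ≤ max K 8 * (s + cc) := h
        _ ≤ max K 8 * cc := mul_le_mul_of_nonneg_left (by linarith [hs.2]) hK8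
    have hI1 : ‖iteratedFDeriv ℝ (0 + 1) (V j s) 0 - iteratedFDeriv ℝ (0 + 1) (V j (-cc)) 0‖ ≤
        2 * (max K 8 * cc) / ρ + 2 * K₂ * ρ :=
      DerivInterp.norm_iteratedFDeriv_succ_sub_le (N := ((⊤ : ℕ∞) : WithTop ℕ∞)) (h := 1)
        (fun y _ => hsm_s.contDiffAt) (fun y _ => hsm_c.contDiffAt)
        (by rw [← WithTop.coe_natCast]; exact WithTop.coe_le_coe.2 le_top)
        hA' hK₂0 (fun y _ => hD_s y) (fun y _ => hD_c y) hρ0 hρ1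
    have hD : ‖fderiv ℝ (V j s) 0 - fderiv ℝ (V j (-cc)) 0‖ ≤
        2 * (max K 8 * cc) / ρ + 2 * K₂ * ρ := by
      rw [norm_fderiv_sub_eq_norm_iteratedFDeriv_one_sub]
      exact hI1
    rw [curl_eq_curlCLM, curl_eq_curlCLM, ← map_sub]
    calc ‖curlCLM (fderiv ℝ (V j s) 0 - fderiv ℝ (V j (-cc)) 0)‖
        ≤ ‖curlCLM‖ * ‖fderiv ℝ (V j s) 0 - fderiv ℝ (V j (-cc)) 0‖ := curlCLM.le_opNorm _
      _ ≤ κ * (2 * (max K 8 * cc) / ρ + 2 * K₂ * ρ) := mul_le_mul_of_nonneg_left hD hκ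
      _ = κ * (2 * max K 8) / ρ * cc + κ * (2 * K₂) * ρ := by
          field_simp
      _ ≤ θ₀ / 4 + θ₀ / 4 := add_le_add hccs hρs
      _ = θ₀ / 2 := by ring
  -- the curl of a classical solution is continuous in time at the apex
  have hcurl_cont : ∀ j, ContinuousAt (fun s : ℝ => curl (V j s) 0) 0 := by
    intro j
    have h1 : ContinuousOn (fun z : ℝ × EuclideanSpace ℝ (Fin 3) => fderiv ℝ (V j z.1) z.2)
        (Ioo (A j) (B j) ×ˢ univ) :=
      (hVcl j).smooth_velocity.continuousOn_fderiv_slice (uniqueDiffOn_Ioo _ _)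
    have hg : Continuous fun s : ℝ => (s, (0 : EuclideanSpace ℝ (Fin 3))) :=
      continuous_id.prodMk continuous_const
    have h2 : ContinuousOn (fun s : ℝ => fderiv ℝ (V j s) 0) (Ioo (A j) (B j)) :=
      h1.comp hg.continuousOn fun s hs => ⟨hs, mem_univ _⟩
    have h0mem : Ioo (A j) (B j) ∈ 𝓝 (0 : ℝ) := Ioo_mem_nhds (by linarith [hA2 j]) (hBpos j)
    have h3 : ContinuousAt (fun s : ℝ => fderiv ℝ (V j s) 0) 0 := h2.continuousAt h0mem
    have h4 : (fun s : ℝ => curl (V j s) 0) = fun s => curlCLM (fderiv ℝ (V j s) 0) := by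
      funext s; rw [curl_eq_curlCLM]
    rw [h4]
    exact curlCLM.continuous.continuousAt.comp h3
  have hend : ∀ j, ‖curl (V j 0) 0 - curl (V j (-cc)) 0‖ ≤ θ₀ / 2 := by
    intro j
    have ht : Tendsto (fun s : ℝ => ‖curl (V j s) 0 - curl (V j (-cc)) 0‖) (𝓝[<] 0)
        (𝓝 ‖curl (V j 0) 0 - curl (V j (-cc)) 0‖) :=
      (((hcurl_cont j).tendsto.sub_const _).norm).mono_left nhdsWithin_le_nhds
    refine le_of_tendsto ht ?_
    have hmem : Ioo (-cc) 0 ∈ 𝓝[<] (0 : ℝ) := Ioo_mem_nhdsLT (by linarith)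
    filter_upwards [hmem] with s hs using hkey j s hs
  have hVc_lower : ∀ j, θ₀ / 2 ≤ ‖curl (V j (-cc)) 0‖ := fun j => by
    have h1 := hend j
    have h2 := hVcurl0 j
    have h3 := norm_sub_norm_le (curl (V j 0) 0) (curl (V j (-cc)) 0)
    linarith
  have hcneg : -cc < 0 := by linarith
  have hWlower : θ₀ / 2 ≤ ‖curl (W (-cc)) 0‖ :=
    ge_of_tendsto ((hWcurl (-cc) hcneg 0).norm) (Eventually.of_forall fun i => hVc_lower (φ i))
  -- ### Step 8: conclusion
  refine ⟨W, ?_, fun s hs => (hWsm s hs).continuous.aestronglyMeasurable, -cc, hcneg, ?_⟩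
  · exact isBoundedAncientMildSolution_of_oseen one_pos hWc ⟨1, hWbd⟩ hWdiv
      (fun s t hst ht x => by rw [one_mul]; exact hWmild s t hst ht x)
  · rintro ⟨b, hb⟩
    have h0 : curl (W (-cc)) 0 = 0 :=
      curl_eq_zero_of_ae_eq_const (hWsm _ hcneg).continuous hb 0
    rw [h0, norm_zero] at hWlower
    linarith

end PaceZoom

end Summit.NavierStokesRegularity.NavierStokesRegularity.Theorems

end
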